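import Summits.CriticalPhenomena.PercolationContinuityZ3.Theorems.PercNearOneGluingNoHeavyLowerTailSahiCoSunflowerPrivateCoordinate
import Mathlib.Tactic.Linarith
import Mathlib.Tactic.Ring
import HarnessLib

/-!
# `NoHeavyLowerTail` (crux stmt-CriticalPhenomena-4575), master-family line P1: the two-level form of the co-sunflower class at a GENERAL private
# coordinate — exact identity, the closed form of P2's Bernstein piece there, and the reduction of the law to one inequality on the sections

Support file (seat `prim-masterthm-p1`, gen 8; `--supports stmt-CriticalPhenomena-4575`).  No definition, no `sorry`, standard axioms.
Memo `run/shared/lean/prim/prim-masterthm/FROM-prim-masterthm-p1-g8-PRIVATE-COORDINATE.md` §2b.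

`…SahiCoSunflowerPrivateCoordinate` proves the co-sunflower two-level law (`CoSunflowerTwoLevel` shape) at a private coordinate `e` of `G₃` when one
`e`-section of `G₃` is extreme (bottom `∅`: `G₃ = {e∈ω} ∩ K`; top `univ`: `G₃ = {e∈ω} ∪ H`).  For a GENERAL private coordinate — `G₁, G₂` ignore `e`,
`G₃` has sections `H = G₃^{e←0} ⊆ K = G₃^{e←1}` — the sections of `U = (G₂∪G₃, G₁∪G₃, G₁∪G₂)` are the nested pair `(G₂∪H, G₁∪H, W) ⊆ (G₂∪K, G₁∪K, W)`,
`W = G₁ ∪ G₂`, and THIS FILE proves, for ANY four events and every product weight (a ring identity on the Venn cells):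
* `twoLevelForm_pairUnion_pair_eq` —
    `T((G₂∪K,G₁∪K,W),(G₂∪H,G₁∪H,W)) = E_3(G₂∪H,G₁∪H,W) + E_3(G₂∪K,G₁∪K,W) + (2 − m(W))·n₁n₂ − α·(n₁ + n₂)`,
  `n₁ = m(G₂∪K) − m(G₂∪H)`, `n₂ = m(G₁∪K) − m(G₁∪H)`, `α = m(W∪K) − m(W∪H)` (for `H ⊆ K`: `n₁ = μ(K∖(G₂∪H))`, `n₂ = μ(K∖(G₁∪H))`, `α = μ(K∖(W∪H))`);
* `coordPiece₂_privateCoord_eq` — hence P2's second Bernstein piece at such a coordinate is `b₂(e) = (2 − m(W))·n₁n₂ − α(n₁+n₂)` (the fibre is quadratic, `b₁ = b₂`);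
* `coSunflowerTwoLevel_privateCoord_of_sections` — the law at `e` holds iff `E_3(U⁰) + E_3(U¹) ≥ α(n₁+n₂) − (2 − m(W))n₁n₂`; in particular it holds whenever
  `α(n₁+n₂) ≤ (2 − m(W))·n₁n₂` given Sahi's `C_3` for the two section triples.
In the reflected sunflower picture: `2β₁ = β_L + β_M + (1+c)ν₁ν₂ − α(ν₁+ν₂)`.  The seat's census (exact, ≤ 5 coordinates) finds `2β₁ ≥ β_L` always; its pseudo-point
computation (memo §3) shows the inequality is NOT a consequence of Harris-type inequalities and `C_3` of the sections unless `H = ∅` or `K = univ`.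
HONEST FRAMING: identities and a reduction; the law at a general private coordinate, the class law and Kahn's Conjecture 5 remain OPEN. [this work]
-/

noncomputable section

open scoped Classical

namespace Summit.CriticalPhenomena.PercolationContinuityZ3.Theorems

namespace SahiCoSunflowerPrivate

open Finset Function
open Literature.Combinatorics.Sahi2008
open Literature.Probability.Percolation.DecisionTree (ind ind_of_mem ind_of_not_mem ind_nonneg)
open SahiCoordinateBernstein (coordPiece₂)

variable {ι : Type} [Fintype ι]

local notation3 (prettyPrint := false) "m⟦" p ", " X "⟧" => ex (bernoulliWeight p) (ind X)

/-! ### 1. `E_3` of a pair-union triple in Venn cells -/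

/-- `E_3(G₂∪K, G₁∪K, G₁∪G₂)` in the seven Venn-cell moments of `(G₁, G₂, K)` (any events, product weight). [this work] -/
theorem sahiE_three_pairUnion_venn (p : ι → unitInterval) (G₁ G₂ K : Set (Set ι)) :
    sahiE (bernoulliWeight p) 3 ![ind (G₂ ∪ K), ind (G₁ ∪ K), ind (G₁ ∪ G₂)] =
      2 * (m⟦p, G₁ ∩ G₂⟧ + m⟦p, G₁ ∩ K⟧ + m⟦p, G₂ ∩ K⟧ - 2 * m⟦p, G₁ ∩ G₂ ∩ K⟧)
        + (m⟦p, G₂⟧ + m⟦p, K⟧ - m⟦p, G₂ ∩ K⟧) * (m⟦p, G₁⟧ + m⟦p, K⟧ - m⟦p, G₁ ∩ K⟧) * (m⟦p, G₁⟧ + m⟦p, G₂⟧ - m⟦p, G₁ ∩ G₂⟧)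
        - ((m⟦p, G₂⟧ + m⟦p, K⟧ - m⟦p, G₂ ∩ K⟧) * (m⟦p, G₁⟧ + m⟦p, G₂ ∩ K⟧ - m⟦p, G₁ ∩ G₂ ∩ K⟧)
          + (m⟦p, G₁⟧ + m⟦p, K⟧ - m⟦p, G₁ ∩ K⟧) * (m⟦p, G₂⟧ + m⟦p, G₁ ∩ K⟧ - m⟦p, G₁ ∩ G₂ ∩ K⟧)
          + (m⟦p, G₁⟧ + m⟦p, G₂⟧ - m⟦p, G₁ ∩ G₂⟧) * (m⟦p, G₁ ∩ G₂⟧ + m⟦p, K⟧ - m⟦p, G₁ ∩ G₂ ∩ K⟧)) := by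
  rw [sahiE_three]
  simp only [ind_mul_ind_eq_inter]
  set μ := bernoulliWeight p with hμ
  have e3 : ex μ (ind ((G₂ ∪ K) ∩ (G₁ ∪ K) ∩ (G₁ ∪ G₂))) = ex μ (ind (G₁ ∩ G₂)) + ex μ (ind (G₁ ∩ K)) + ex μ (ind (G₂ ∩ K))
      - ex μ (ind (G₁ ∩ G₂ ∩ K)) - ex μ (ind (G₁ ∩ G₂ ∩ K)) := by
    rw [ind_top3_eq]; simp only [ex_add, SahiCombDisjunct.ex_sub']
  have e12 : ex μ (ind ((G₁ ∪ K) ∩ (G₁ ∪ G₂))) = ex μ (ind G₁) + ex μ (ind (G₂ ∩ K)) - ex μ (ind (G₁ ∩ G₂ ∩ K)) := by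
    rw [ind_top12_eq]; simp only [ex_add, SahiCombDisjunct.ex_sub']
  have e02 : ex μ (ind ((G₂ ∪ K) ∩ (G₁ ∪ G₂))) = ex μ (ind G₂) + ex μ (ind (G₁ ∩ K)) - ex μ (ind (G₁ ∩ G₂ ∩ K)) := by
    rw [ind_top02_eq]; simp only [ex_add, SahiCombDisjunct.ex_sub']
  have e01 : ex μ (ind ((G₂ ∪ K) ∩ (G₁ ∪ K))) = ex μ (ind (G₁ ∩ G₂)) + ex μ (ind K) - ex μ (ind (G₁ ∩ G₂ ∩ K)) := by
    rw [ind_top01_eq]; simp only [ex_add, SahiCombDisjunct.ex_sub']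
  have eW : ex μ (ind (G₁ ∪ G₂)) = ex μ (ind G₁) + ex μ (ind G₂) - ex μ (ind (G₁ ∩ G₂)) :=
    SahiCoSunflowerOrCoordinate.ex_ind_union μ G₁ G₂
  have eG2K : ex μ (ind (G₂ ∪ K)) = ex μ (ind G₂) + ex μ (ind K) - ex μ (ind (G₂ ∩ K)) :=
    SahiCoSunflowerOrCoordinate.ex_ind_union μ G₂ K
  have eG1K : ex μ (ind (G₁ ∪ K)) = ex μ (ind G₁) + ex μ (ind K) - ex μ (ind (G₁ ∩ K)) :=
    SahiCoSunflowerOrCoordinate.ex_ind_union μ G₁ K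
  rw [e3, e12, e02, e01, eW, eG2K, eG1K]
  ring

/-! ### 2. The identity for the general private coordinate -/

/-- **THE GENERAL PRIVATE-COORDINATE IDENTITY.**  For any events `G₁, G₂, H, K` (product weight), `W = G₁ ∪ G₂`:
`T((G₂∪K,G₁∪K,W),(G₂∪H,G₁∪H,W)) = E_3(G₂∪H,G₁∪H,W) + E_3(G₂∪K,G₁∪K,W) + (2 − m(W))·n₁n₂ − α·(n₁+n₂)` with `n₁ = m(G₂∪K) − m(G₂∪H)`,
`n₂ = m(G₁∪K) − m(G₁∪H)`, `α = m(W∪K) − m(W∪H)`. [this work] -/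
theorem twoLevelForm_pairUnion_pair_eq (p : ι → unitInterval) (G₁ G₂ H K : Set (Set ι)) :
    twoLevelForm (fun X => ex (bernoulliWeight p) (ind X)) ![G₂ ∪ K, G₁ ∪ K, G₁ ∪ G₂] ![G₂ ∪ H, G₁ ∪ H, G₁ ∪ G₂] =
      sahiE (bernoulliWeight p) 3 ![ind (G₂ ∪ H), ind (G₁ ∪ H), ind (G₁ ∪ G₂)]
        + sahiE (bernoulliWeight p) 3 ![ind (G₂ ∪ K), ind (G₁ ∪ K), ind (G₁ ∪ G₂)]
        + (2 - m⟦p, G₁ ∪ G₂⟧) * (m⟦p, G₂ ∪ K⟧ - m⟦p, G₂ ∪ H⟧) * (m⟦p, G₁ ∪ K⟧ - m⟦p, G₁ ∪ H⟧)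
        - (m⟦p, G₁ ∪ G₂ ∪ K⟧ - m⟦p, G₁ ∪ G₂ ∪ H⟧) * ((m⟦p, G₂ ∪ K⟧ - m⟦p, G₂ ∪ H⟧) + (m⟦p, G₁ ∪ K⟧ - m⟦p, G₁ ∪ H⟧)) := by
  rw [sahiE_three_pairUnion_venn, sahiE_three_pairUnion_venn, twoLevelForm]
  simp only [Matrix.cons_val_zero, Matrix.cons_val_one, Matrix.cons_val]
  set μ := bernoulliWeight p with hμ
  have t3 : ex μ (ind ((G₂ ∪ K) ∩ (G₁ ∪ K) ∩ (G₁ ∪ G₂))) = ex μ (ind (G₁ ∩ G₂)) + ex μ (ind (G₁ ∩ K)) + ex μ (ind (G₂ ∩ K))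
      - ex μ (ind (G₁ ∩ G₂ ∩ K)) - ex μ (ind (G₁ ∩ G₂ ∩ K)) := by
    rw [ind_top3_eq]; simp only [ex_add, SahiCombDisjunct.ex_sub']
  have t12 : ex μ (ind ((G₁ ∪ K) ∩ (G₁ ∪ G₂))) = ex μ (ind G₁) + ex μ (ind (G₂ ∩ K)) - ex μ (ind (G₁ ∩ G₂ ∩ K)) := by
    rw [ind_top12_eq]; simp only [ex_add, SahiCombDisjunct.ex_sub']
  have t02 : ex μ (ind ((G₂ ∪ K) ∩ (G₁ ∪ G₂))) = ex μ (ind G₂) + ex μ (ind (G₁ ∩ K)) - ex μ (ind (G₁ ∩ G₂ ∩ K)) := by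
    rw [ind_top02_eq]; simp only [ex_add, SahiCombDisjunct.ex_sub']
  have t01 : ex μ (ind ((G₂ ∪ K) ∩ (G₁ ∪ K))) = ex μ (ind (G₁ ∩ G₂)) + ex μ (ind K) - ex μ (ind (G₁ ∩ G₂ ∩ K)) := by
    rw [ind_top01_eq]; simp only [ex_add, SahiCombDisjunct.ex_sub']
  have b3 : ex μ (ind ((G₂ ∪ H) ∩ (G₁ ∪ H) ∩ (G₁ ∪ G₂))) = ex μ (ind (G₁ ∩ G₂)) + ex μ (ind (G₁ ∩ H)) + ex μ (ind (G₂ ∩ H))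
      - ex μ (ind (G₁ ∩ G₂ ∩ H)) - ex μ (ind (G₁ ∩ G₂ ∩ H)) := by
    rw [ind_top3_eq]; simp only [ex_add, SahiCombDisjunct.ex_sub']
  have b12 : ex μ (ind ((G₁ ∪ H) ∩ (G₁ ∪ G₂))) = ex μ (ind G₁) + ex μ (ind (G₂ ∩ H)) - ex μ (ind (G₁ ∩ G₂ ∩ H)) := by
    rw [ind_top12_eq]; simp only [ex_add, SahiCombDisjunct.ex_sub']
  have b02 : ex μ (ind ((G₂ ∪ H) ∩ (G₁ ∪ G₂))) = ex μ (ind G₂) + ex μ (ind (G₁ ∩ H)) - ex μ (ind (G₁ ∩ G₂ ∩ H)) := by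
    rw [ind_top02_eq]; simp only [ex_add, SahiCombDisjunct.ex_sub']
  have b01 : ex μ (ind ((G₂ ∪ H) ∩ (G₁ ∪ H))) = ex μ (ind (G₁ ∩ G₂)) + ex μ (ind H) - ex μ (ind (G₁ ∩ G₂ ∩ H)) := by
    rw [ind_top01_eq]; simp only [ex_add, SahiCombDisjunct.ex_sub']
  have eW : ex μ (ind (G₁ ∪ G₂)) = ex μ (ind G₁) + ex μ (ind G₂) - ex μ (ind (G₁ ∩ G₂)) :=
    SahiCoSunflowerOrCoordinate.ex_ind_union μ G₁ G₂
  have eG2K : ex μ (ind (G₂ ∪ K)) = ex μ (ind G₂) + ex μ (ind K) - ex μ (ind (G₂ ∩ K)) :=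
    SahiCoSunflowerOrCoordinate.ex_ind_union μ G₂ K
  have eG1K : ex μ (ind (G₁ ∪ K)) = ex μ (ind G₁) + ex μ (ind K) - ex μ (ind (G₁ ∩ K)) :=
    SahiCoSunflowerOrCoordinate.ex_ind_union μ G₁ K
  have eG2H : ex μ (ind (G₂ ∪ H)) = ex μ (ind G₂) + ex μ (ind H) - ex μ (ind (G₂ ∩ H)) :=
    SahiCoSunflowerOrCoordinate.ex_ind_union μ G₂ H
  have eG1H : ex μ (ind (G₁ ∪ H)) = ex μ (ind G₁) + ex μ (ind H) - ex μ (ind (G₁ ∩ H)) :=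
    SahiCoSunflowerOrCoordinate.ex_ind_union μ G₁ H
  have eWK : ex μ (ind (G₁ ∪ G₂ ∪ K)) = ex μ (ind G₁) + ex μ (ind G₂) + ex μ (ind K) - ex μ (ind (G₁ ∩ G₂))
      - ex μ (ind (G₁ ∩ K)) - ex μ (ind (G₂ ∩ K)) + ex μ (ind (G₁ ∩ G₂ ∩ K)) := by
    rw [ind_union3_eq]; simp only [ex_add, SahiCombDisjunct.ex_sub']
  have eWH : ex μ (ind (G₁ ∪ G₂ ∪ H)) = ex μ (ind G₁) + ex μ (ind G₂) + ex μ (ind H) - ex μ (ind (G₁ ∩ G₂))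
      - ex μ (ind (G₁ ∩ H)) - ex μ (ind (G₂ ∩ H)) + ex μ (ind (G₁ ∩ G₂ ∩ H)) := by
    rw [ind_union3_eq]; simp only [ex_add, SahiCombDisjunct.ex_sub']
  rw [b3, b12, b02, b01, t3, t12, t02, t01, eWK, eWH, eW, eG2K, eG1K, eG2H, eG1H]
  ring

/-! ### 3. The Bernstein piece and the reduction at a general private coordinate -/

omit [Fintype ι] in
/-- Sections of the members `G_i ∪ (H ∪ ({e∈ω} ∩ K))` and `G₁ ∪ G₂` for `e`-ignoring `G₁, G₂, H ⊆ K`: top `(G₂∪K, G₁∪K, W)`, bottom `(G₂∪H, G₁∪H, W)`.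
[folklore] -/
theorem secAt_glue_members (e : ι) {G₁ G₂ H K : Set (Set ι)} (h₁e : ∀ b, secAt e b G₁ = G₁) (h₂e : ∀ b, secAt e b G₂ = G₂)
    (hH : ∀ b, secAt e b H = H) (hK : ∀ b, secAt e b K = K) (hHK : H ⊆ K) :
    secAt e true (G₂ ∪ (H ∪ ({ω : Set ι | e ∈ ω} ∩ K))) = G₂ ∪ K ∧ secAt e false (G₂ ∪ (H ∪ ({ω : Set ι | e ∈ ω} ∩ K))) = G₂ ∪ H ∧
      secAt e true (G₁ ∪ (H ∪ ({ω : Set ι | e ∈ ω} ∩ K))) = G₁ ∪ K ∧ secAt e false (G₁ ∪ (H ∪ ({ω : Set ι | e ∈ ω} ∩ K))) = G₁ ∪ H ∧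
      secAt e true (G₁ ∪ G₂) = G₁ ∪ G₂ ∧ secAt e false (G₁ ∪ G₂) = G₁ ∪ G₂ := by
  obtain ⟨sT, sF⟩ := secAt_coordMeet e hK
  have gT : secAt e true (H ∪ ({ω : Set ι | e ∈ ω} ∩ K)) = K := by
    rw [SahiCombDisjunct.secAt_union, sT, hH, Set.union_eq_right.2 hHK]
  have gF : secAt e false (H ∪ ({ω : Set ι | e ∈ ω} ∩ K)) = H := by
    rw [SahiCombDisjunct.secAt_union, sF, hH, Set.union_empty]
  refine ⟨?_, ?_, ?_, ?_, ?_, ?_⟩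
  · rw [SahiCombDisjunct.secAt_union, h₂e, gT]
  · rw [SahiCombDisjunct.secAt_union, h₂e, gF]
  · rw [SahiCombDisjunct.secAt_union, h₁e, gT]
  · rw [SahiCombDisjunct.secAt_union, h₁e, gF]
  · rw [SahiCombDisjunct.secAt_union, h₁e, h₂e]
  · rw [SahiCombDisjunct.secAt_union, h₁e, h₂e]

/-- **P2's Bernstein piece at a general private coordinate, in closed form.**  For `G₁, G₂, H ⊆ K` ignoring `e` and `G₃ = H ∪ ({e∈ω} ∩ K)`
(so `G₃^{e←0} = H`, `G₃^{e←1} = K`), with `U = (G₂∪G₃, G₁∪G₃, G₁∪G₂)`, `W = G₁ ∪ G₂`: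
`b₂(e) = (2 − m(W))·n₁n₂ − α(n₁+n₂)`, `n₁ = m(G₂∪K) − m(G₂∪H)`, `n₂ = m(G₁∪K) − m(G₁∪H)`, `α = m(W∪K) − m(W∪H)`. [this work] -/
theorem coordPiece₂_privateCoord_eq (p : ι → unitInterval) (e : ι) {G₁ G₂ H K : Set (Set ι)} (h₁e : ∀ b, secAt e b G₁ = G₁)
    (h₂e : ∀ b, secAt e b G₂ = G₂) (hHe : ∀ b, secAt e b H = H) (hKe : ∀ b, secAt e b K = K) (hHK : H ⊆ K) :
    coordPiece₂ p e ![G₂ ∪ (H ∪ ({ω : Set ι | e ∈ ω} ∩ K)), G₁ ∪ (H ∪ ({ω : Set ι | e ∈ ω} ∩ K)), G₁ ∪ G₂] =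
      (2 - m⟦p, G₁ ∪ G₂⟧) * (m⟦p, G₂ ∪ K⟧ - m⟦p, G₂ ∪ H⟧) * (m⟦p, G₁ ∪ K⟧ - m⟦p, G₁ ∪ H⟧)
        - (m⟦p, G₁ ∪ G₂ ∪ K⟧ - m⟦p, G₁ ∪ G₂ ∪ H⟧) * ((m⟦p, G₂ ∪ K⟧ - m⟦p, G₂ ∪ H⟧) + (m⟦p, G₁ ∪ K⟧ - m⟦p, G₁ ∪ H⟧)) := by
  obtain ⟨m2T, m2F, m1T, m1F, m3T, m3F⟩ := secAt_glue_members e h₁e h₂e hHe hKe hHK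
  have hbridge := SahiTwoLevel.coordPiece₂_add_eq_twoLevelPlus p e (G₂ ∪ (H ∪ ({ω : Set ι | e ∈ ω} ∩ K)))
    (G₁ ∪ (H ∪ ({ω : Set ι | e ∈ ω} ∩ K))) (G₁ ∪ G₂)
  rw [m2T, m2F, m1T, m1F, m3T, m3F, Fin.prod_univ_three] at hbridge
  simp only [Matrix.cons_val_zero, Matrix.cons_val_one, Matrix.cons_val, sub_self, mul_zero, sub_zero] at hbridge
  rw [twoLevelForm_pairUnion_pair_eq] at hbridge
  linarith

/-- **REDUCTION at a general private coordinate.**  Under the same hypotheses, the co-sunflower two-level law at `e` (the body of `CoSunflowerTwoLevel`)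
holds as soon as `E_3(U⁰) + E_3(U¹) ≥ α(n₁+n₂) − (2 − m(W))·n₁n₂` (`U⁰, U¹` the section triples of `(G₁,G₂,H)` and `(G₁,G₂,K)`); in particular whenever
`α(n₁+n₂) ≤ (2 − m(W))·n₁n₂` and the two section triples satisfy Sahi's `C_3`. [this work] -/
theorem coSunflowerTwoLevel_privateCoord_of_sections (p : ι → unitInterval) (e : ι) {G₁ G₂ H K : Set (Set ι)}
    (h₁e : ∀ b, secAt e b G₁ = G₁) (h₂e : ∀ b, secAt e b G₂ = G₂) (hHe : ∀ b, secAt e b H = H) (hKe : ∀ b, secAt e b K = K)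
    (hHK : H ⊆ K)
    (hineq : (m⟦p, G₁ ∪ G₂ ∪ K⟧ - m⟦p, G₁ ∪ G₂ ∪ H⟧) * ((m⟦p, G₂ ∪ K⟧ - m⟦p, G₂ ∪ H⟧) + (m⟦p, G₁ ∪ K⟧ - m⟦p, G₁ ∪ H⟧))
        - (2 - m⟦p, G₁ ∪ G₂⟧) * (m⟦p, G₂ ∪ K⟧ - m⟦p, G₂ ∪ H⟧) * (m⟦p, G₁ ∪ K⟧ - m⟦p, G₁ ∪ H⟧) ≤
        sahiE (bernoulliWeight p) 3 ![ind (G₂ ∪ H), ind (G₁ ∪ H), ind (G₁ ∪ G₂)]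
          + sahiE (bernoulliWeight p) 3 ![ind (G₂ ∪ K), ind (G₁ ∪ K), ind (G₁ ∪ G₂)]) :
    0 ≤ coordPiece₂ p e ![G₂ ∪ (H ∪ ({ω : Set ι | e ∈ ω} ∩ K)), G₁ ∪ (H ∪ ({ω : Set ι | e ∈ ω} ∩ K)), G₁ ∪ G₂]
      + sahiE (bernoulliWeight p) 3
          ![ind (secAt e false (G₂ ∪ (H ∪ ({ω : Set ι | e ∈ ω} ∩ K)))), ind (secAt e false (G₁ ∪ (H ∪ ({ω : Set ι | e ∈ ω} ∩ K)))),
            ind (secAt e false (G₁ ∪ G₂))]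
      + sahiE (bernoulliWeight p) 3
          ![ind (secAt e true (G₂ ∪ (H ∪ ({ω : Set ι | e ∈ ω} ∩ K)))), ind (secAt e true (G₁ ∪ (H ∪ ({ω : Set ι | e ∈ ω} ∩ K)))),
            ind (secAt e true (G₁ ∪ G₂))] := by
  obtain ⟨m2T, m2F, m1T, m1F, m3T, m3F⟩ := secAt_glue_members e h₁e h₂e hHe hKe hHK
  rw [coordPiece₂_privateCoord_eq p e h₁e h₂e hHe hKe hHK, m2T, m2F, m1T, m1F, m3T, m3F]
  linarith

end SahiCoSunflowerPrivate

end Summit.CriticalPhenomena.PercolationContinuityZ3.Theorems
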